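import Summits.QuantumFields.YangMills.Theorems.BalabanUVNodesK3V5Defs
import Summits.QuantumFields.YangMills.Theorems.BalabanUVNodesN16PinnedDataSmallField
import Summits.QuantumFields.YangMills.Theorems.BalabanUVNodesN21HolderWidth

/-!
# N21 (NE7c) · (t-N16b) FROM N21's SIDE, THE ROAD-I HAND: road I's N16 → N21 junction AT THE K3⁷ v5 LOOSE-PINNED READING — its data row
# `V ∈ dom` IS the radius row `V ∈ sfClass 4 F.L Nper ((ℓ₃ F).ε ∕ B F) 0` — and the kernel certificate «v5's stub-1 text is UPWARD-CLOSED in `B`»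
# (K3⁷ v5 delivers NO floor under N16's loose data radius; a road-I closer must DISPLAY one)

Width seat `pub-ymgap-dag-n21-w6` (g0; second wave, director-ym R405 ∕ №209; dag-lead WIDTH-209 N21 PIECE 3 (t-N16b)), node N21 = NE7c (NOT PRINTED
in [Bałaban 1983–89], NOT proved), crux K3⁷ `SpineGivenEndpointR13SepCoPH` (stmt-QuantumFields-20544; `--kind proof --supports … --as helper`,
count-neutral).  THEOREMS ONLY: 0 `def`, 0 `sorry`, standard axioms.  Consumes BY NAME: dag-n27-w1's tree mirror `…K3V5Defs` of the registered v5
texts (`GuardedReadingN16`, `N16RadiusMatch`, `KeyedRatesHolderD4`, `rrOfRecord`, `PHolderD4`), dag-n16-e's module 43 `…N16PinnedLayer13CoPH`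
(`N16PinnedLoose`, `N16LettersEnd`, `rateCarriers_ne3_of_pinnedLoose`) and module 44 `…N16PinnedDataSmallField` (`sfClass_zero_mono`), dag-n16-c's
`N16HolderDefs.CovRootHolder ∕ N16HolderAt`, and ROAD I's R-β junction `N21HolderWidth.dev_close_of_covRoot_holder ∕ relWidth_of_covRoot_holder`
(dag-n21-d g4, on n21-a's `N21ClosenessJunction`).

WHY (the located question (t-N16b), plan g82 START-LIST v10 §2∕§4, skeleton v5 header l.17–35).  K3⁷ v5 pins node N16's NE3 layer LOOSE:
`N16PinnedLoose 𝔯 ℓ₃ B` makes the layer the constant layer of record with its DATA CUT by print's (7)-ball of radius `(ℓ₃ F).ε ∕ B F`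
([Balaban1985Variational] Thm 1 (7) p. 279), `B : T4Family → ℝ` a FREE letter rowed only by `N16RadiusMatch ℓ₃ B : 0 < B F ∧ (ℓ₃ F).ε ∕ B F ≤ (ℓ₃ F).b`
— an UPPER bound on the radius.  The plan asked the n19 ∕ n21 lanes whether a consumer reads a FLOOR under that radius («B → ∞ (near-flat data
only) is content-poor but not vacuous — THE END's radius FLOOR, if its consumer needs one, is the next located row»).  n21-e g21 answered for the
collar road (38s∕38t) and n21-w1's chart END, n21-w4 g0 for the response road (f8∕f12): NO N16 letter read.  THIS FILE reads the one N21 place where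
N16 IS consumed — ROAD I (n21-a files 3∕6∕7 `N21ClosenessJunction …`, dag-n21-d `N21AtKeyedRateHome` §2–§3 in the `N16At` currency and
`N21HolderWidth` §2 in the R-β currency; v5's own row `N16LettersEnd` carries road I's numeral `512·(4+1)·(4+4)·L²·b ≤ 1` as «what node N21 reads off
N16's letters», module 43 :110) — and records, in kernel:
* §1  WHAT THE PINNED READING's N16 OBJECT IS, per tuple and run length: block factor `F.L`, period `ne3NperOfRecord₁₁ F 0 0`, THE END's letters
  `(ℓ₃ F).ε ∕ b ∕ g ∕ C ∕ Λ₁ ∕ Λ₂'`, and data `{V | V ∈ ne3DomOfRecord₁₁ F N 0 0 ∧ V ∈ sfClass 4 F.L (ne3NperOfRecord₁₁ F 0 0) ((ℓ₃ F).ε ∕ B F) 0}`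
  (`rateCarriers_ne3_eq_of_pinnedLoose`); hence K3⁷'s N16 conjunct `N16HolderAt (…).ne3 β` at the pinned reading IS dag-n16-c's β-root
  `CovRootHolder` OVER THAT LOOSE DATA SET (`n16HolderAt_rateCarriers_iff_of_pinnedLoose`) — a root that quantifies `∀ V ∈ dom`.
* §2  ROAD I AT THE PINNED READING (★ `dev_close_of_pinnedLoose_holder`, ★ `relWidth_of_pinnedLoose_holder`): road I's two-run closeness
  `|‖U_A(∂p) − 1‖ − ‖W(∂p) − 1‖| ≤ C_Q·(θ^k)^{10+3β}` and its (F∞)-rate binder in threshold units, BY NAME over `N21HolderWidth` §2, from (i) the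
  pin, (ii) K3⁷'s N16 conjunct at ANY one bundle of the reading (the sentence is tuple-free under the pin), (iii) v5's row `N16LettersEnd` (which
  DISCHARGES road I's sign letters `1 ≤ Nper`, `0 ≤ b`, `0 ≤ g`, `0 ≤ C`, `0 < Λ₂′` and its numeral `hbs`), (iv) road I's own side letters
  (`θ⁶ = L⁻¹`, `γ`, `l₁`, fit, a level `k ≥ 1`, the two minimisers, `U_B` regular) and (v) THE DISPLAYED DATA ROW
  `hV0 : V ∈ ne3DomOfRecord₁₁ F N 0 0`, `hVr : V ∈ sfClass 4 F.L (ne3NperOfRecord₁₁ F 0 0) ((ℓ₃ F).ε ∕ B F) 0` — THE (t-N16b) ROW ON N21's SIDE: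
  road I covers a run datum exactly if it is `(ℓ₃ F).ε∕B F`-small-field at level 0.  `dataRow_of_smallField_of_le`: a cut-radius row `r ≤ (ℓ₃ F).ε ∕ B F`
  transports every `r`-small-field datum of record into the row (the SHAPE of the re-cut row a road-I closer of `KeyedShellWeight` would display).
* §3  THE KERNEL CERTIFICATE «NO FLOOR FROM v5» (N = 2, the registered texts BY NAME): `covRootHolder_anti_dom` (the β-root is ANTITONE in its data
  set), `looseDom_anti` (the loose data set SHRINKS as `B` grows), `n16RadiusMatch_of_le` (the match row is UPWARD-closed in `B`), and
  ★★ `guardedReadingN16_keyedRates_of_le`: from `GuardedReadingN16 𝔯 ksel ℓ ℓ₃ g B ∧ KeyedRatesHolderD4 β (rrOfRecord 𝔯 ksel)` and ANY `B' ≥ B`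
  (pointwise) the SAME two conjuncts hold for the reading RE-PINNED LOOSE AT `B'` (its N16 layer replaced, `ne1 ∕ ne2 ∕ u3` untouched — every other
  conjunct of the guard and of `PHolderD4` is ne3-blind, module 43's `eraseNE3` faces; the N16 conjunct passes to FEWER data; `0 < (ℓ₃ F).ε` comes from
  `N16LettersEnd`'s `InEndRegimeH`); hence ★★★ `stub1Text_of_stub1Text_floorFree`: IF stub 1's registered text holds THEN it holds with `B ≥ M`
  for every real `M` — K3⁷ v5's stub 1 CANNOT bound N16's loose data radius from below, so NO stub-2 proof can extract a floor from its hypotheses: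
  a consumer that needs the cut's data inside N16's loose ball (road I, §2) must DISPLAY the row; the live N21 roads of record (road II
  `…ShellSplitOfRecord13CoPHStat` ★★★★, the selected top cut, the collars, the chart END, the response road) display NO N16 letter at all.

WORDS OF RECORD this file sits under.  Reading owner dag-n21-d g10 (pub-ymgap INBOX l.29177, 05:14Z): from the shell-split side of `crOfRecord₁₃At`
NO NE3 letter is read either; «N16's closeness radius meets N21 only through N19′'s choice `ρ_K :=` that radius» — so §2 is LINEAGE bookkeeping for
road I AS TYPED (the two-run closeness now feeds N19′'s width letter), and §3 is the certificate of record.  Plan g83 WORDS-1b (D)(4) (INBOX l.29306):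
the one N21 row that would enter the guard, `r_cut F ≤ (ℓ₃ F).ε ∕ B F` (§2's `dataRow_of_smallField_of_le`), is ARMED-CONDITIONAL (t-N16b′) — it fires
ONLY if a road-I closer names it as consumed; K3⁷ v5's guard STANDS.

HONEST FRAMING.  [bookkeeping] over landed definitions + two monotonicities; the β-root ∕ `N16HolderAt` (node N16, NE3 at exponent β) is a HYPOTHESIS —
NOT PRINTED as typed, NOT proved; road I's (M1)∕[dict] ledgers are untouched and NOT claimed; whether road I is on the closing path of
`KeyedShellWeight` is the plan's ∕ the reading owner's word (above), not asserted here; nothing of Bałaban's is asserted or instantiated; (M1) ∕ NE7c NOT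
PRINTED ∕ NOT proved; **N21 NOT discharged**; K3⁷ NOT claimed and its skeleton of record (plan g82 v5 941dddb108cbaacf) NOT edited (only its tree
mirror is imported); counts UNMOVED (typed 28∕28 · discharged 5∕27, A 5∕28); one finite 𝕋⁴ programme at fixed ε — R4 would close the CONDITIONAL
finite-𝕋⁴ rung `BalabanLadder.UV` only; NOT ℝ⁴ ∕ continuum ∕ OS ∕ mass gap ∕ Clay.  The Yang–Mills mass gap is NOT proved by any of this.
-/

set_option autoImplicit false

open scoped BigOperators Matrix Matrix.Norms.L2Operator

namespace Summit.QuantumFields.YangMills.Theorems.N21RoadIAtN16LoosePinnedReading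

open Literature.MathematicalPhysics.QuantumFieldTheory.Balaban1983to89
open Literature.MathematicalPhysics.QuantumFieldTheory.Balaban1983to89.T4Continuum (T4Family ULoop)
open B7Prop1Explicit B7Prop2Explicit
open T4AveragingDeficitWall hiding Site Plane Plaq Bond
open T4AveragingDeficitWallBoundary (periodBox)
open Summit.QuantumFields.BalabanUV.T4Continuum
open AveragingDeficitPeriodicCounting (IsPeriodicDir)
open AveragingDeficitDualResidual (dualC1 dualC2)
open AveragingDeficitDerivWallProof (wallConst)
open MinimalActionSandwich (IsMinimiser)
open MinimalActionRate (Regular sfClass)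
open NE3EnergyShapes (residualScale IsUnitarySite IsPeriodicSite)
open NE3EnergyWeightedShapes (energyNormW)
open Node00 (Stage13HParams NE3Objects₁₁ NE3Letters₁₁ ne3ConstLayerOfRecord₁₁ ne3NperOfRecord₁₁ ne3DomOfRecord₁₁ one_le_ne3NperOfRecord₁₁
  mem_ne3DomOfRecord₁₁_iff_periodic_su MatA)
open B8Ineq130 (hol_one)
open YMDAG.UVSplit (NE3Carriers ne3OfRecord₁₁ RateReading₁₃CoPH rateCarriersOfRecord₁₃CoPH)
open Summit.QuantumFields.YangMills.BalabanUVNodes.N16HolderDefs (CovRootHolder N16HolderAt)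
open Summit.QuantumFields.YangMills.BalabanUVNodes.N16HolderRegime (InEndRegimeH constOfRecordH_nonneg)
open Summit.QuantumFields.YangMills.BalabanUVNodes.N16PinnedLayer13CoPH (N16PinnedLoose N16LettersEnd rateCarriers_ne3_of_pinnedLoose)
open Summit.QuantumFields.YangMills.BalabanUVNodes.N16PinnedDataSmallField (sfClass_zero_mono)
open Summit.QuantumFields.YangMills.Theorems.N21HolderWidth (dev_close_of_covRoot_holder relWidth_of_covRoot_holder)
open Summit.QuantumFields.YangMills.Theorems.K3V5Defs (RunSel LetterReading rrOfRecord PHolderD4 KeyedRatesHolderD4 GuardedReading N16RadiusMatch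
  GuardedReadingN16)

noncomputable section

/-! ## §1 The N16 object of the loose-pinned reading, per tuple and run length; K3⁷'s N16 conjunct there = the β-root over the loose data -/

section Object

variable {N : ℕ} [NeZero N] {𝔯 : RateReading₁₃CoPH N} {ℓ₃ : T4Family → NE3Letters₁₁} {B : T4Family → ℝ}

/-- **THE N16 CARRIER OF THE LOOSE-PINNED READING, FIELD BY FIELD**: at every Stage-13 tuple with core provisos and every run length, block factor
`F.L`, period `ne3NperOfRecord₁₁ F 0 0`, THE END's letters read by `ℓ₃`, data = the record's unit-lattice data CUT by the (7)-ball of radius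
`(ℓ₃ F).ε ∕ B F` (module 43's `rateCarriers_ne3_of_pinnedLoose`, then `rfl`). [bookkeeping] -/
theorem rateCarriers_ne3_eq_of_pinnedLoose (h : N16PinnedLoose 𝔯 ℓ₃ B) (F : T4Family) (θ : Stage13HParams F N) (hP : θ.Provisos₁₃CoPH F N)
    (g₀ : ℕ → ℝ) (os : List (ULoop F)) (k : ℕ) :
    (rateCarriersOfRecord₁₃CoPH 𝔯 F θ hP g₀ os k).ne3 =
      ⟨F.L, ne3NperOfRecord₁₁ F 0 0, (ℓ₃ F).ε, (ℓ₃ F).b, (ℓ₃ F).g, (ℓ₃ F).C, (ℓ₃ F).Λ₁, (ℓ₃ F).Λ₂',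
        {V | V ∈ ne3DomOfRecord₁₁ F N 0 0 ∧ V ∈ sfClass 4 F.L (ne3NperOfRecord₁₁ F 0 0) ((ℓ₃ F).ε / B F) 0}⟩ := by
  rw [rateCarriers_ne3_of_pinnedLoose h]
  rfl

/-- **THE DATA OF THE PINNED READING's N16 OBJECT** (the set road I's `hV` must hit). [bookkeeping] -/
theorem rateCarriers_ne3_dom_of_pinnedLoose (h : N16PinnedLoose 𝔯 ℓ₃ B) (F : T4Family) (θ : Stage13HParams F N) (hP : θ.Provisos₁₃CoPH F N)
    (g₀ : ℕ → ℝ) (os : List (ULoop F)) (k : ℕ) :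
    (rateCarriersOfRecord₁₃CoPH 𝔯 F θ hP g₀ os k).ne3.dom =
      {V | V ∈ ne3DomOfRecord₁₁ F N 0 0 ∧ V ∈ sfClass 4 F.L (ne3NperOfRecord₁₁ F 0 0) ((ℓ₃ F).ε / B F) 0} := by
  rw [rateCarriers_ne3_eq_of_pinnedLoose h]

/-- Membership form of the data row. [bookkeeping] -/
theorem mem_rateCarriers_ne3_dom_iff_of_pinnedLoose (h : N16PinnedLoose 𝔯 ℓ₃ B) (F : T4Family) (θ : Stage13HParams F N)
    (hP : θ.Provisos₁₃CoPH F N) (g₀ : ℕ → ℝ) (os : List (ULoop F)) (k : ℕ) (V : Site 4 → Fin 4 → (MatA N)ˣ) :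
    V ∈ (rateCarriersOfRecord₁₃CoPH 𝔯 F θ hP g₀ os k).ne3.dom ↔
      V ∈ ne3DomOfRecord₁₁ F N 0 0 ∧ V ∈ sfClass 4 F.L (ne3NperOfRecord₁₁ F 0 0) ((ℓ₃ F).ε / B F) 0 := by
  rw [rateCarriers_ne3_dom_of_pinnedLoose h]
  rfl

/-- **K3⁷'s N16 CONJUNCT AT THE PINNED READING IS THE β-ROOT OVER THE LOOSE DATA** (`N16HolderAt` unfolded at §1's carrier): for every `β`,
`N16HolderAt (rateCarriersOfRecord₁₃CoPH 𝔯 F θ hP g₀ os k).ne3 β ↔ CovRootHolder 4 (sfClass 4 F.L Nper₀ (ℓ₃ F).ε) F.L Nper₀ b g C Λ₁ Λ₂′ β (loose data)`,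
`Nper₀ = ne3NperOfRecord₁₁ F 0 0` — a sentence `∀ k ≥ 1, ∀ V ∈ loose data, …`, tuple-free. [bookkeeping] -/
theorem n16HolderAt_rateCarriers_iff_of_pinnedLoose (h : N16PinnedLoose 𝔯 ℓ₃ B) (F : T4Family) (θ : Stage13HParams F N)
    (hP : θ.Provisos₁₃CoPH F N) (g₀ : ℕ → ℝ) (os : List (ULoop F)) (k : ℕ) (β : ℝ) :
    N16HolderAt (rateCarriersOfRecord₁₃CoPH 𝔯 F θ hP g₀ os k).ne3 β ↔
      CovRootHolder 4 (sfClass 4 F.L (ne3NperOfRecord₁₁ F 0 0) (ℓ₃ F).ε) F.L (ne3NperOfRecord₁₁ F 0 0) (ℓ₃ F).b (ℓ₃ F).g (ℓ₃ F).C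
        (ℓ₃ F).Λ₁ (ℓ₃ F).Λ₂' β
        {V | V ∈ ne3DomOfRecord₁₁ F N 0 0 ∧ V ∈ sfClass 4 F.L (ne3NperOfRecord₁₁ F 0 0) ((ℓ₃ F).ε / B F) 0} := by
  rw [rateCarriers_ne3_eq_of_pinnedLoose h]
  rfl

/-- **THE END's ROW DISCHARGES ROAD I's SIGN LETTERS** at the loose object: from v5's `N16LettersEnd N g ℓ₃` (its `InEndRegimeH` conjunct at the
constant layer, whose letters and period are the loose object's) — `1 ≤ Nper₀`, `0 < (ℓ₃ F).ε`, `0 < (ℓ₃ F).b`, `0 < (ℓ₃ F).g`, `0 ≤ (ℓ₃ F).C`,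
`0 < (ℓ₃ F).Λ₂'` and road I's numeral `512·(4+1)·(4+4)·L²·b ≤ 1`. [bookkeeping] -/
theorem roadI_signs_of_n16LettersEnd {g : T4Family → ℝ} (hEnd : N16LettersEnd N g ℓ₃) (F : T4Family) :
    1 ≤ ne3NperOfRecord₁₁ F 0 0 ∧ 0 < (ℓ₃ F).ε ∧ 0 < (ℓ₃ F).b ∧ 0 < (ℓ₃ F).g ∧ 0 ≤ (ℓ₃ F).C ∧ 0 < (ℓ₃ F).Λ₂' ∧
      512 * (4 + 1) * (4 + 4) * (F.L : ℝ) ^ 2 * (ℓ₃ F).b ≤ 1 := by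
  obtain ⟨-, -, -, hb, hbs, hΛ₂', hreg⟩ := hEnd F
  obtain ⟨hL, hN, hg, hε, -, -, -, -, -, hC⟩ := hreg
  exact ⟨one_le_ne3NperOfRecord₁₁ F 0 0, hε, hb, hg, (constOfRecordH_nonneg hL hN hg).trans hC, hΛ₂', hbs⟩

end Object

/-! ## §2 ROAD I's N16 → N21 junction AT THE LOOSE-PINNED READING — the data row displayed as the radius row (t-N16b) -/

section RoadI

variable {N : ℕ} [NeZero N] {𝔯 : RateReading₁₃CoPH N} {ℓ₃ : T4Family → NE3Letters₁₁} {B g : T4Family → ℝ}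

/-- ★ **ROAD I's TWO-RUN CLOSENESS AT THE v5 LOOSE-PINNED READING.**  HYPOTHESES: the pin `N16PinnedLoose 𝔯 ℓ₃ B` and THE END's row
`N16LettersEnd N g ℓ₃` (two conjuncts of v5's `GuardedReadingN16`); K3⁷'s N16 conjunct `N16HolderAt (rateCarriersOfRecord₁₃CoPH 𝔯 F θ hP g₀ os k').ne3 β`
at ANY ONE bundle of the family (what `KeyedRatesHolderD4 β (rrOfRecord 𝔯 ksel)` delivers per guarded admissible tuple under its prefix; `β ≤ 2`);
road I's own side letters at `F` (`θ⁶ = L⁻¹`, budget `γ` with `C·ρ₄ ≤ γ³`, cube root `l₁` of `Λ₁`, a level `k ≥ 1` past the fit `γ(θ^k)² ≤ l₁·Nper₀`);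
run A's minimiser `U_A` at level `k` and run B's `U_B` at level `k+1` over the datum `V`, `U_B` regular; and THE DATA ROW — the (t-N16b) row on
N21's side — `hV0 : V ∈ ne3DomOfRecord₁₁ F N 0 0` (a unit-lattice datum of record) and `hVr : V ∈ sfClass 4 F.L Nper₀ ((ℓ₃ F).ε ∕ B F) 0` (the datum
is `(ℓ₃ F).ε∕B F`-SMALL-FIELD at level 0).  CONCLUSION: at every plaquette `|‖U_A(∂p) − 1‖ − ‖W(∂p) − 1‖| ≤ C_Q·(θ^k)^{10+3β}`,
`W = rescale L (bavg L U_B)`, `C_Q = 8l₁√(2γΛ₂′) + 1536l₁⁴γ²e^{8l₁²γ}` — `N21HolderWidth.dev_close_of_covRoot_holder` BY NAME, its `hV : V ∈ dom`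
supplied by `⟨hV0, hVr⟩` through §1, its sign letters by `roadI_signs_of_n16LettersEnd`.  CONDITIONAL on the β-root (hypothesis (ii)). [bookkeeping] -/
theorem dev_close_of_pinnedLoose_holder (hpin : N16PinnedLoose 𝔯 ℓ₃ B) (hEnd : N16LettersEnd N g ℓ₃)
    {F : T4Family} {θ : Stage13HParams F N} {hP : θ.Provisos₁₃CoPH F N} {g₀ : ℕ → ℝ} {os : List (ULoop F)} {k' : ℕ} {β : ℝ} (hβ2 : β ≤ 2)
    (h16 : N16HolderAt (rateCarriersOfRecord₁₃CoPH 𝔯 F θ hP g₀ os k').ne3 β)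
    {ϑ γ l₁ : ℝ} {k : ℕ} (hϑ : 0 < ϑ) (hϑ6 : ϑ ^ 6 = ((F.L : ℝ))⁻¹) (hγ : 0 < γ)
    (hγ3 : (ℓ₃ F).C * (wallConst 4 F.L * (ne3NperOfRecord₁₁ F 0 0 : ℝ) ^ 2 *
      (Real.sqrt (ℓ₃ F).g * dualC2 4 F.L + 2 * (ℓ₃ F).b ^ 2 * dualC1 4 F.L)) ≤ γ ^ 3)
    (hl₁ : 0 < l₁) (hΛl₁ : (ℓ₃ F).Λ₁ ≤ l₁ ^ 3) (hk : 1 ≤ k) (hfit : γ * (ϑ ^ k) ^ 2 ≤ l₁ * (ne3NperOfRecord₁₁ F 0 0 : ℝ))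
    {V UA UB : Site 4 → Fin 4 → (MatA N)ˣ}
    (hV0 : V ∈ ne3DomOfRecord₁₁ F N 0 0) (hVr : V ∈ sfClass 4 F.L (ne3NperOfRecord₁₁ F 0 0) ((ℓ₃ F).ε / B F) 0)
    (hA : IsMinimiser 4 (sfClass 4 F.L (ne3NperOfRecord₁₁ F 0 0) (ℓ₃ F).ε) F.L (ne3NperOfRecord₁₁ F 0 0) k V UA)
    (hB : IsMinimiser 4 (sfClass 4 F.L (ne3NperOfRecord₁₁ F 0 0) (ℓ₃ F).ε) F.L (ne3NperOfRecord₁₁ F 0 0) (k + 1) V UB)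
    (hreg : Regular 4 F.L (ne3NperOfRecord₁₁ F 0 0) (ℓ₃ F).b (ℓ₃ F).g (k + 1) UB)
    (z : Site 4) (μ ν : Fin 4) :
    |‖((hol UA z (plaqWord μ ν) : (MatA N)ˣ) : MatA N) - 1‖
        - ‖((hol (rescale F.L (bavg F.L UB)) z (plaqWord μ ν) : (MatA N)ˣ) : MatA N) - 1‖|
      ≤ (8 * l₁ * Real.sqrt (2 * γ * (ℓ₃ F).Λ₂') + 1536 * l₁ ^ 4 * γ ^ 2 * Real.exp (8 * l₁ ^ 2 * γ))
          * (ϑ ^ k) ^ ((10 : ℝ) + 3 * β) := by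
  haveI : Nonempty (Fin N) := ⟨⟨0, Nat.pos_of_ne_zero (NeZero.ne N)⟩⟩
  have hL : 2 ≤ F.L := by have := F.hL11; omega
  obtain ⟨hN, -, hb, hg, hC, hΛ₂', hbs⟩ := roadI_signs_of_n16LettersEnd hEnd F
  have hroot := (n16HolderAt_rateCarriers_iff_of_pinnedLoose hpin F θ hP g₀ os k' β).1 h16
  exact dev_close_of_covRoot_holder hL hN hϑ hϑ6 hb.le hbs hg.le hC hΛ₂' hβ2 hroot hγ hγ3 hl₁ hΛl₁ hk hfit ⟨hV0, hVr⟩ hA hB hreg z μ ν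

/-- ★ **ROAD I's (F∞) RATE BINDER AT THE v5 LOOSE-PINNED READING**, in threshold units: under the hypotheses of `dev_close_of_pinnedLoose_holder`
and for any threshold `t ≥ ε′·(L⁻¹)^{2k}` (`ε′ > 0`), `|‖U_A(∂p) − 1‖ − ‖W(∂p) − 1‖| ∕ t ≤ (C_Q∕ε′)·(θ^{3β−2})^k` —
`N21HolderWidth.relWidth_of_covRoot_holder` BY NAME with the same data row.  CONDITIONAL on the β-root. [bookkeeping] -/
theorem relWidth_of_pinnedLoose_holder (hpin : N16PinnedLoose 𝔯 ℓ₃ B) (hEnd : N16LettersEnd N g ℓ₃)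
    {F : T4Family} {θ : Stage13HParams F N} {hP : θ.Provisos₁₃CoPH F N} {g₀ : ℕ → ℝ} {os : List (ULoop F)} {k' : ℕ} {β : ℝ} (hβ2 : β ≤ 2)
    (h16 : N16HolderAt (rateCarriersOfRecord₁₃CoPH 𝔯 F θ hP g₀ os k').ne3 β)
    {ϑ γ l₁ : ℝ} {k : ℕ} (hϑ : 0 < ϑ) (hϑ6 : ϑ ^ 6 = ((F.L : ℝ))⁻¹) (hγ : 0 < γ)
    (hγ3 : (ℓ₃ F).C * (wallConst 4 F.L * (ne3NperOfRecord₁₁ F 0 0 : ℝ) ^ 2 *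
      (Real.sqrt (ℓ₃ F).g * dualC2 4 F.L + 2 * (ℓ₃ F).b ^ 2 * dualC1 4 F.L)) ≤ γ ^ 3)
    (hl₁ : 0 < l₁) (hΛl₁ : (ℓ₃ F).Λ₁ ≤ l₁ ^ 3) (hk : 1 ≤ k) (hfit : γ * (ϑ ^ k) ^ 2 ≤ l₁ * (ne3NperOfRecord₁₁ F 0 0 : ℝ))
    {V UA UB : Site 4 → Fin 4 → (MatA N)ˣ}
    (hV0 : V ∈ ne3DomOfRecord₁₁ F N 0 0) (hVr : V ∈ sfClass 4 F.L (ne3NperOfRecord₁₁ F 0 0) ((ℓ₃ F).ε / B F) 0)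
    (hA : IsMinimiser 4 (sfClass 4 F.L (ne3NperOfRecord₁₁ F 0 0) (ℓ₃ F).ε) F.L (ne3NperOfRecord₁₁ F 0 0) k V UA)
    (hB : IsMinimiser 4 (sfClass 4 F.L (ne3NperOfRecord₁₁ F 0 0) (ℓ₃ F).ε) F.L (ne3NperOfRecord₁₁ F 0 0) (k + 1) V UB)
    (hreg : Regular 4 F.L (ne3NperOfRecord₁₁ F 0 0) (ℓ₃ F).b (ℓ₃ F).g (k + 1) UB)
    {ε' t : ℝ} (hε' : 0 < ε') (ht : ε' * ((F.L : ℝ)⁻¹) ^ (2 * k) ≤ t) (z : Site 4) (μ ν : Fin 4) :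
    |‖((hol UA z (plaqWord μ ν) : (MatA N)ˣ) : MatA N) - 1‖
        - ‖((hol (rescale F.L (bavg F.L UB)) z (plaqWord μ ν) : (MatA N)ˣ) : MatA N) - 1‖| / t
      ≤ (8 * l₁ * Real.sqrt (2 * γ * (ℓ₃ F).Λ₂') + 1536 * l₁ ^ 4 * γ ^ 2 * Real.exp (8 * l₁ ^ 2 * γ)) / ε'
          * (ϑ ^ ((3 : ℝ) * β - 2)) ^ k := by
  haveI : Nonempty (Fin N) := ⟨⟨0, Nat.pos_of_ne_zero (NeZero.ne N)⟩⟩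
  have hL : 2 ≤ F.L := by have := F.hL11; omega
  obtain ⟨hN, -, hb, hg, hC, hΛ₂', hbs⟩ := roadI_signs_of_n16LettersEnd hEnd F
  have hroot := (n16HolderAt_rateCarriers_iff_of_pinnedLoose hpin F θ hP g₀ os k' β).1 h16
  exact relWidth_of_covRoot_holder hL hN hϑ hϑ6 hb.le hbs hg.le hC hΛ₂' hβ2 hroot hγ hγ3 hl₁ hΛl₁ hk hfit ⟨hV0, hVr⟩ hA hB hreg hε' ht z μ ν

omit [NeZero N] in
/-- **THE SHAPE OF THE RE-CUT ROW** (if road I is to close `KeyedShellWeight`): a cut-radius row `r ≤ (ℓ₃ F).ε ∕ B F` transports every `r`-small-field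
unit-lattice datum of record into §2's data row (module 44's `sfClass_zero_mono` BY NAME).  Nothing asserts such a row; it is what a road-I closer
would have to DISPLAY. [bookkeeping] -/
theorem dataRow_of_smallField_of_le {F : T4Family} {r : ℝ} (hr : r ≤ (ℓ₃ F).ε / B F) {V : Site 4 → Fin 4 → (MatA N)ˣ}
    (hV0 : V ∈ ne3DomOfRecord₁₁ F N 0 0) (hVr : V ∈ sfClass 4 F.L (ne3NperOfRecord₁₁ F 0 0) r 0) :
    V ∈ {V | V ∈ ne3DomOfRecord₁₁ F N 0 0 ∧ V ∈ sfClass 4 F.L (ne3NperOfRecord₁₁ F 0 0) ((ℓ₃ F).ε / B F) 0} :=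
  ⟨hV0, sfClass_zero_mono hr hVr⟩

omit [NeZero N] in
/-- **A6 · THE DATA ROW IS INHABITED AT EVERY RADIUS `r ≥ 0`: THE FLAT DATUM.**  The unit configuration `1` is a unit-lattice datum of record (periodic,
`SU(N)`-valued) and lies in every level-0 small-field class of radius `r ≥ 0` (all its plaquette holonomies are `1`, `hol_one`) — so §2's data row is
never empty (at the pinned reading `r = (ℓ₃ F).ε ∕ B F > 0` by THE END's row and `0 < B F`): road I at the loose-pinned reading is not vacuous on the data
side; as `B` grows the row shrinks TOWARDS the flat data, never below them («near-flat data only», the plan's wording, in kernel). [bookkeeping] -/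
theorem one_mem_dataRow (F : T4Family) {r : ℝ} (hr : 0 ≤ r) :
    (1 : Site 4 → Fin 4 → (MatA N)ˣ) ∈
      {V : Site 4 → Fin 4 → (MatA N)ˣ | V ∈ ne3DomOfRecord₁₁ F N 0 0 ∧ V ∈ sfClass 4 F.L (ne3NperOfRecord₁₁ F 0 0) r 0} := by
  refine ⟨(mem_ne3DomOfRecord₁₁_iff_periodic_su _).2 ⟨fun _ _ _ => rfl, fun _ _ => ?_⟩,
    fun _ _ => (unitaryUnits (MatA N)).one_mem, fun _ _ _ => rfl, fun x κ κ' _ => ?_⟩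
  · rw [Pi.one_apply, Pi.one_apply, Units.val_one]
    exact Submonoid.one_mem _
  · rw [hol_one, Units.val_one, sub_self, norm_zero]
    exact div_nonneg hr (by positivity)

end RoadI

/-! ## §3 THE KERNEL CERTIFICATE «NO FLOOR FROM v5»: stub 1's registered text is UPWARD-CLOSED in `B` -/

section NoFloor

variable {d : ℕ} {n : Type*} [Fintype n] [DecidableEq n]

/-- **THE β-ROOT IS ANTITONE IN ITS DATA SET**: fewer data, weaker sentence (`∀ V ∈ dom`). [bookkeeping] -/
theorem covRootHolder_anti_dom {𝒞 : ℕ → Set (Site d → Fin d → (Matrix n n ℂ)ˣ)} {L N : ℕ} {b g C Λ₁ Λ₂' β : ℝ}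
    {dom dom' : Set (Site d → Fin d → (Matrix n n ℂ)ˣ)} (hsub : dom' ⊆ dom) (h : CovRootHolder d 𝒞 L N b g C Λ₁ Λ₂' β dom) :
    CovRootHolder d 𝒞 L N b g C Λ₁ Λ₂' β dom' :=
  fun k hk V hV => h k hk V (hsub hV)

end NoFloor

section NoFloorRecord

variable {N : ℕ} [NeZero N]

omit [NeZero N] in
/-- **THE LOOSE DATA SET SHRINKS AS `B` GROWS** (`0 ≤ ε`, `0 < B ≤ B'`): radius `ε∕B' ≤ ε∕B`, `sfClass_zero_mono`. [bookkeeping] -/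
theorem looseDom_anti (F : T4Family) {ε B B' : ℝ} (hε : 0 ≤ ε) (hB : 0 < B) (hBB' : B ≤ B') :
    {V : Site 4 → Fin 4 → (MatA N)ˣ | V ∈ ne3DomOfRecord₁₁ F N 0 0 ∧ V ∈ sfClass 4 F.L (ne3NperOfRecord₁₁ F 0 0) (ε / B') 0} ⊆
      {V | V ∈ ne3DomOfRecord₁₁ F N 0 0 ∧ V ∈ sfClass 4 F.L (ne3NperOfRecord₁₁ F 0 0) (ε / B) 0} :=
  fun _ hV => ⟨hV.1, sfClass_zero_mono (div_le_div_of_nonneg_left hε hB hBB') hV.2⟩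

end NoFloorRecord

section StubText

/-- **v5's RADIUS MATCH ROW IS UPWARD-CLOSED IN `B`** (`0 ≤ (ℓ₃ F).ε`, which THE END's row supplies): `N16RadiusMatch ℓ₃ B → N16RadiusMatch ℓ₃ B'`
for `B ≤ B'` pointwise — the row bounds the loose radius from ABOVE only. [bookkeeping] -/
theorem n16RadiusMatch_of_le {ℓ₃ : T4Family → NE3Letters₁₁} {B B' : T4Family → ℝ} (hε : ∀ F, 0 ≤ (ℓ₃ F).ε) (hBB' : ∀ F, B F ≤ B' F)
    (h : N16RadiusMatch ℓ₃ B) : N16RadiusMatch ℓ₃ B' := fun F =>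
  ⟨(h F).1.trans_le (hBB' F), (div_le_div_of_nonneg_left (hε F) (h F).1 (hBB' F)).trans (h F).2⟩

/-- ★★ **STUB 1's TWO CONJUNCTS ARE UPWARD-CLOSED IN `B`** (the (t-N16b) certificate, registered texts BY NAME via `K3V5Defs`).  From
`GuardedReadingN16 𝔯 ksel ℓ ℓ₃ g B` and `KeyedRatesHolderD4 β (rrOfRecord 𝔯 ksel)` and ANY `B' ≥ B` (pointwise), the reading `𝔯'` RE-PINNED LOOSE
AT `B'` — N16 layer := the constant layer of record with data cut at radius `(ℓ₃ F).ε ∕ B' F`; dressed tower `ne1`, node-U3 objects `u3`, N15 layers `ne2`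
VERBATIM `𝔯`'s — satisfies BOTH conjuncts at `B'`.  Why: the guard's four conjuncts (`Ne1PinnedOfRecord`, `KeyedLive`, `N15PinnedSized`,
`U3PinnedKernels`) and `PHolderD4`'s N14 ∕ N15 ∕ N17 ∕ N18 ∕ N22 ∕ (D4) ∕ ρ members read `ne1 ∕ ne2 ∕ u3` only; `N16LettersEnd` reads `ℓ₃`, not `B`;
`N16RadiusMatch` is upward-closed (`0 < (ℓ₃ F).ε` from THE END's `InEndRegimeH`); and the N16 conjunct — the β-root OVER THE LOOSE DATA (§1) — passes
to the SMALLER data set (`covRootHolder_anti_dom ∘ looseDom_anti`), under the prefix by `ForSmallCouplings.mono`. [bookkeeping] -/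
theorem guardedReadingN16_keyedRates_of_le {β : ℝ} {𝔯 : RateReading₁₃CoPH 2} {ksel : RunSel} {ℓ : LetterReading}
    {ℓ₃ : T4Family → NE3Letters₁₁} {g B B' : T4Family → ℝ}
    (hG : GuardedReadingN16 𝔯 ksel ℓ ℓ₃ g B) (hR : KeyedRatesHolderD4 β (rrOfRecord 𝔯 ksel)) (hBB' : ∀ F, B F ≤ B' F) :
    ∃ 𝔯' : RateReading₁₃CoPH 2,
      𝔯'.ne1 = 𝔯.ne1 ∧
      (∀ (F : T4Family) (θ : Stage13HParams F 2) (hP : θ.Provisos₁₃CoPH F 2) (g₀ : ℕ → ℝ) (os : List (ULoop F)),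
        (𝔯'.lit F θ hP g₀ os).u3 = (𝔯.lit F θ hP g₀ os).u3 ∧ (𝔯'.lit F θ hP g₀ os).ne2 = (𝔯.lit F θ hP g₀ os).ne2) ∧
      GuardedReadingN16 𝔯' ksel ℓ ℓ₃ g B' ∧ KeyedRatesHolderD4 β (rrOfRecord 𝔯' ksel) := by
  obtain ⟨hGR, hpin, hEnd, hmatch⟩ := hG
  have hε : ∀ F, 0 < (ℓ₃ F).ε := fun F => (roadI_signs_of_n16LettersEnd hEnd F).2.1
  -- the reading re-pinned loose at `B'`: N16 layer := constant layer of record with data cut at radius `ε ∕ B'`; `ne1 ∕ u3 ∕ ne2` are `𝔯`'s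
  let 𝔯' : RateReading₁₃CoPH 2 :=
    ⟨fun F θ hP g₀ os => { 𝔯.lit F θ hP g₀ os with
      ne3 := fun _ => { ne3ConstLayerOfRecord₁₁ F 2 (ℓ₃ F) with
        dom := {V | V ∈ ne3DomOfRecord₁₁ F 2 0 0 ∧ V ∈ sfClass 4 F.L (ne3NperOfRecord₁₁ F 0 0) ((ℓ₃ F).ε / B' F) 0} } }, 𝔯.ne1⟩
  have hpin' : N16PinnedLoose 𝔯' ℓ₃ B' := fun _ _ _ _ _ _ => rfl
  refine ⟨𝔯', rfl, fun _ _ _ _ _ => ⟨rfl, rfl⟩, ⟨?_, hpin', hEnd, n16RadiusMatch_of_le (fun F => (hε F).le) hBB' hmatch⟩, ?_⟩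
  · -- the v4 guard is ne3-blind (`ne1 ∕ ne2 ∕ u3` of `𝔯'` are `𝔯`'s by `rfl`)
    obtain ⟨h14, h15, h15p, hu3⟩ := hGR
    exact ⟨h14, h15, h15p, hu3⟩
  · -- the rates: every member but N16's is ne3-blind; N16's β-root passes to the smaller loose data set
    intro F θ hP hGd hAdm hB hE
    refine (hR F θ hP hGd hAdm hB hE).mono fun g₀ hall os => ?_
    obtain ⟨⟨h14, h15, h16, h17, h18, h22⟩, hD4, hρ⟩ := hall os
    refine ⟨⟨h14, h15, ?_, h17, h18, h22⟩, hD4, hρ⟩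
    have hroot := (n16HolderAt_rateCarriers_iff_of_pinnedLoose hpin F θ hP g₀ os (ksel F θ hP g₀ os) β).1 h16
    exact (n16HolderAt_rateCarriers_iff_of_pinnedLoose hpin' F θ hP g₀ os (ksel F θ hP g₀ os) β).2
      (covRootHolder_anti_dom (looseDom_anti F (hε F).le (hmatch F).1 (hBB' F)) hroot)

/-- ★★★ **STUB 1's REGISTERED TEXT IS FLOOR-FREE**: IF K3⁷ v5's `stub_rates13H` text holds (hypothesis `h`, VERBATIM in the `K3V5Defs` names), THEN for
EVERY real `M` it holds with a letter `B ≥ M` pointwise — i.e. with N16's loose data radius `(ℓ₃ F).ε ∕ B F ≤ (ℓ₃ F).ε ∕ M` as small as one likes.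
So NO stub-2 proof can extract a lower bound on that radius from stub 2's hypotheses `GuardedReadingN16 … B ∧ KeyedRatesHolderD4 …`: a consumer that
needs the kept cut's data inside N16's loose ball (road I, §2's `hVr`) must DISPLAY that row — the (t-N16b) answer from N21's road-I side; the live N21
roads display no N16 letter at all.  Nothing here asserts stub 1. [bookkeeping] -/
theorem stub1Text_of_stub1Text_floorFree
    (h : ∃ β : ℝ, 2 / 3 < β ∧ β < 1 ∧ ∃ (𝔯 : RateReading₁₃CoPH 2) (ksel : RunSel) (ℓ : LetterReading)
      (ℓ₃ : T4Family → Node00.NE3Letters₁₁) (g B : T4Family → ℝ), GuardedReadingN16 𝔯 ksel ℓ ℓ₃ g B ∧ KeyedRatesHolderD4 β (rrOfRecord 𝔯 ksel))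
    (M : ℝ) :
    ∃ β : ℝ, 2 / 3 < β ∧ β < 1 ∧ ∃ (𝔯 : RateReading₁₃CoPH 2) (ksel : RunSel) (ℓ : LetterReading)
      (ℓ₃ : T4Family → Node00.NE3Letters₁₁) (g B : T4Family → ℝ), (∀ F, M ≤ B F) ∧
        GuardedReadingN16 𝔯 ksel ℓ ℓ₃ g B ∧ KeyedRatesHolderD4 β (rrOfRecord 𝔯 ksel) := by
  obtain ⟨β, hβ₁, hβ₂, 𝔯, ksel, ℓ, ℓ₃, g, B, hG, hR⟩ := h
  obtain ⟨𝔯', -, -, hG', hR'⟩ := guardedReadingN16_keyedRates_of_le (B' := fun F => max (B F) M) hG hR fun F => le_max_left _ _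
  exact ⟨β, hβ₁, hβ₂, 𝔯', ksel, ℓ, ℓ₃, g, fun F => max (B F) M, fun F => le_max_right _ _, hG', hR'⟩

/-- … and the loose data radius of such a witness is at most `(ℓ₃ F).ε ∕ M` for `M > 0` (`0 ≤ (ℓ₃ F).ε` from THE END's row). [bookkeeping] -/
theorem looseRadius_le_of_le {ℓ₃ : T4Family → NE3Letters₁₁} {B : T4Family → ℝ} {M : ℝ} (hM : 0 < M) (hMB : ∀ F, M ≤ B F)
    (hε : ∀ F, 0 ≤ (ℓ₃ F).ε) (F : T4Family) : (ℓ₃ F).ε / B F ≤ (ℓ₃ F).ε / M :=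
  div_le_div_of_nonneg_left (hε F) hM (hMB F)

end StubText

/-! ## §4 (v1.1, append-only) WHAT STUB 2's REGISTERED TEXT THEREFORE OWES AT THE RE-PINNED READINGS — N19′'s core edge with N16 on near-flat data only -/

section StubTwo

open Summit.QuantumFields.YangMills.Theorems.K3V5Defs (CutReading SpineReading PinnedAtLive KeyedRelWeight KeyedShellWeight KeyedExtraction
  KeyedCoreEdgeHolderD4)
open YMDAG.UVSplit (ShellSplit₁₃CoPH)

/-- ★★★★ **STUB 2's REGISTERED TEXT, IF PROVED, DELIVERS ITS FOUR FACES — N19′'s CORE EDGE INCLUDED — AT READINGS WHOSE N16 DATA RADIUS IS AS SMALL AS ONE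
LIKES.**  Hypothesis `H2` = K3⁷ v5's `stub_expansion13H` text VERBATIM (in the `K3V5Defs` names; NOT asserted — nobody's theorem).  For any stub-1-shaped data
`(β, 𝔯, ksel, ℓ, ℓ₃, g, B)` (guard + keyed rates) and ANY real `M`, there is a reading `𝔯'` RE-PINNED LOOSE at a letter `B' ≥ M` (pointwise; `ne1 ∕ u3 ∕ ne2` verbatim
`𝔯`'s, so the SAME N14 ∕ N15 ∕ N17 ∕ N18 ∕ N22 ∕ (D4) content and N16's β-root on the data of radius `(ℓ₃ F).ε ∕ B' F ≤ (ℓ₃ F).ε ∕ M` ONLY) at which `H2` must — and does —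
produce `jc, sh, cr` pinned at live with `KeyedRelWeight ∧ KeyedShellWeight ∧ KeyedExtraction ∧ KeyedCoreEdgeHolderD4 β cr (rrOfRecord 𝔯' ksel)`.  Reading: inside
`KeyedCoreEdgeHolderD4` the rates enter as the HYPOTHESIS `PHolderD4 β D (rrOfRecord 𝔯' ksel …)`, whose N16 member speaks of near-flat data only; the core classes of
`cr = crOfRecord₁₃V (jc …) sh` on the live line are the record's (print's thresholds) and do not move with `B'`.  So a proof of stub 2 AS KEYED is a proof of N19′'s
two-run core matching with node N16's closeness available on an arbitrarily small data ball — unless a ROW ties `B` to the kept cut ((t-N16b′), plan g83).  This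
theorem asserts nothing beyond the composition ★★ ∘ `H2`. [bookkeeping] -/
theorem stub2Text_forces_faces_at_rePinned
    (H2 : ∀ β : ℝ, 2 / 3 < β → β < 1 → ∀ (𝔯 : RateReading₁₃CoPH 2) (ksel : RunSel) (ℓ : LetterReading)
      (ℓ₃ : T4Family → Node00.NE3Letters₁₁) (g B : T4Family → ℝ), GuardedReadingN16 𝔯 ksel ℓ ℓ₃ g B → KeyedRatesHolderD4 β (rrOfRecord 𝔯 ksel) →
        ∃ (jc : CutReading) (sh : ShellSplit₁₃CoPH 2 0) (cr : SpineReading),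
          PinnedAtLive jc sh cr ∧ KeyedRelWeight cr ∧ KeyedShellWeight cr ∧ KeyedExtraction cr ∧ KeyedCoreEdgeHolderD4 β cr (rrOfRecord 𝔯 ksel))
    {β : ℝ} (hβ₁ : 2 / 3 < β) (hβ₂ : β < 1) {𝔯 : RateReading₁₃CoPH 2} {ksel : RunSel} {ℓ : LetterReading} {ℓ₃ : T4Family → NE3Letters₁₁} {g B : T4Family → ℝ}
    (hG : GuardedReadingN16 𝔯 ksel ℓ ℓ₃ g B) (hR : KeyedRatesHolderD4 β (rrOfRecord 𝔯 ksel)) (M : ℝ) :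
    ∃ (B' : T4Family → ℝ) (𝔯' : RateReading₁₃CoPH 2), (∀ F, M ≤ B' F) ∧ (∀ F, B F ≤ B' F) ∧
      𝔯'.ne1 = 𝔯.ne1 ∧
      (∀ (F : T4Family) (θ : Stage13HParams F 2) (hP : θ.Provisos₁₃CoPH F 2) (g₀ : ℕ → ℝ) (os : List (ULoop F)),
        (𝔯'.lit F θ hP g₀ os).u3 = (𝔯.lit F θ hP g₀ os).u3 ∧ (𝔯'.lit F θ hP g₀ os).ne2 = (𝔯.lit F θ hP g₀ os).ne2) ∧
      GuardedReadingN16 𝔯' ksel ℓ ℓ₃ g B' ∧ KeyedRatesHolderD4 β (rrOfRecord 𝔯' ksel) ∧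
      ∃ (jc : CutReading) (sh : ShellSplit₁₃CoPH 2 0) (cr : SpineReading),
        PinnedAtLive jc sh cr ∧ KeyedRelWeight cr ∧ KeyedShellWeight cr ∧ KeyedExtraction cr ∧ KeyedCoreEdgeHolderD4 β cr (rrOfRecord 𝔯' ksel) := by
  obtain ⟨𝔯', h1, h2, hG', hR'⟩ :=
    guardedReadingN16_keyedRates_of_le (B' := fun F => max (B F) M) hG hR fun F => le_max_left _ _
  exact ⟨fun F => max (B F) M, 𝔯', fun F => le_max_right _ _, fun F => le_max_left _ _, h1, h2, hG', hR',
    H2 β hβ₁ hβ₂ 𝔯' ksel ℓ ℓ₃ g _ hG' hR'⟩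

/-- … and at such a reading N16's data radius is at most `(ℓ₃ F).ε ∕ M` (`M > 0`; `0 < (ℓ₃ F).ε` from THE END's row inside the guard). [bookkeeping] -/
theorem looseRadius_le_of_guardedReadingN16 {𝔯 : RateReading₁₃CoPH 2} {ksel : RunSel} {ℓ : LetterReading} {ℓ₃ : T4Family → NE3Letters₁₁}
    {g B : T4Family → ℝ} (hG : GuardedReadingN16 𝔯 ksel ℓ ℓ₃ g B) {M : ℝ} (hM : 0 < M) (hMB : ∀ F, M ≤ B F) (F : T4Family) :
    (ℓ₃ F).ε / B F ≤ (ℓ₃ F).ε / M :=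
  looseRadius_le_of_le hM hMB (fun F => (roadI_signs_of_n16LettersEnd hG.2.2.1 F).2.1.le) F

end StubTwo

end

end Summit.QuantumFields.YangMills.Theorems.N21RoadIAtN16LoosePinnedReading
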